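import Mathlib
import Summits.Ventures.PercRepro2.Tail2DBlockCalc
import Summits.Ventures.PercRepro2.Tail2DHarrisSP
import Summits.Ventures.PercRepro2.Tail2DFlowOneBlocks
import Summits.Ventures.PercRepro2.Tail2DFlowOneStep01
import Summits.Ventures.PercRepro2.Tail2DParFin
import Summits.Ventures.PercRepro2.Tail2DParFinFlip
import Summits.Ventures.PercRepro2.Tail2DParFinTop
import Summits.Ventures.PercRepro2.Tail2DParFinDiag
import Summits.Ventures.PercRepro2.Tail2DParFinCount
import Summits.Ventures.PercRepro2.Tail2DParFinRelax
import Summits.Ventures.PercRepro2.Tail2DParFinSubTop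
import Summits.Ventures.PercRepro2.Tail2DParFinSubTopB
import Summits.Ventures.PercRepro2.Tail2DParFinSubTopD
import Summits.Ventures.PercRepro2.Tail2DParFinFibres
import Summits.Ventures.PercRepro2.Tail2DOneChange
import Summits.Ventures.PercRepro2.Tail2DOneChangeB
import Summits.Ventures.PercRepro2.Tail2DOneChangeC
import Summits.Ventures.PercRepro2.Tail2DFourIdent
import Summits.Ventures.PercRepro2.Tail2DSixIdent40
import Summits.Ventures.PercRepro2.Tail2DSixIdent31
import Summits.Ventures.PercRepro2.Tail2DSixIdent30
import Summits.Ventures.PercRepro2.Tail2DSixIdent20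
import Summits.Ventures.PercRepro2.Tail2DSixIdent20S
import Summits.Ventures.PercRepro2.Tail2DSixIdent20T

/-!
# (SD) at EVERY clipped position on six identical flow-one factors
(seat mine-b, cell pub-perc-repro2; conjectures/MINE-B.md §44)

The red-heavy positions `(2,0)`, `(3,0)`, `(4,0)`, `(3,1)` by the explicit one-change tables
(`Tail2DSixIdent*`), the blue-heavy ones `(1,1)`, `(1,2)`, `(1,3)`, `(2,2)` by the colour swap,
the rest by the top / sub-top / diagonal / axis theorems and the empty tails.
-/

namespace Summit.Ventures.PercRepro2.Tail2D

open V2Closure Finset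

namespace Six

variable {Y : V2Closure.SP}

/-- `(1,1)` by the colour swap -/
theorem sdomZ_six_11 (hY : FlowOne Y) (hR : 0 < (rSet Y).card) : SDomZ (parFin 6 (fun _ => Y)) 1 1 := by
  have h := IdentSix20.sdomZ_ident_Six20 hY hR
  rw [sdomZ_swap_iff] at h
  norm_num at h
  exact h

/-- `(1,2)` by the colour swap -/
theorem sdomZ_six_12 (hY : FlowOne Y) (hR : 0 < (rSet Y).card) : SDomZ (parFin 6 (fun _ => Y)) 1 2 := by
  have h := IdentSix30.sdomZ_ident_Six30 hY hR
  rw [sdomZ_swap_iff] at h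
  norm_num at h
  exact h

/-- `(1,3)` by the colour swap -/
theorem sdomZ_six_13 (hY : FlowOne Y) (hR : 0 < (rSet Y).card) : SDomZ (parFin 6 (fun _ => Y)) 1 3 := by
  have h := IdentSix40.sdomZ_ident_Six40 hY hR
  rw [sdomZ_swap_iff] at h
  norm_num at h
  exact h

/-- `(2,2)` by the colour swap -/
theorem sdomZ_six_22 (hY : FlowOne Y) (hR : 0 < (rSet Y).card) : SDomZ (parFin 6 (fun _ => Y)) 2 2 := by
  have h := IdentSix31.sdomZ_ident_Six31 hY hR
  rw [sdomZ_swap_iff] at h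
  norm_num at h
  exact h

/-- **(SD) at EVERY clipped position on six copies of `Y`** for any flow-one `Y` with a red crossing -/
theorem sdomZ_six_all (hY : FlowOne Y) (hR : 0 < (rSet Y).card) (u v : ℤ) :
    SDomZ (parFin 6 (fun _ => Y)) u v := by
  have hX : ∀ i : Fin 6, FlowOne ((fun _ => Y) i) := fun _ => hY
  have hR' : ∀ i : Fin 6, 0 < (rSet ((fun _ => Y) i)).card := fun _ => hR
  by_cases haxis : u ≤ 0 ∨ v ≤ -1
  · exact sdomZ_axisComb_axis (axisComb_parFin 6 (fun _ => Y) (fun _ => ⟨hY, hR⟩)) u v haxis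
  push Not at haxis
  obtain ⟨u', rfl⟩ : ∃ u' : ℕ, u = u' := ⟨u.toNat, by omega⟩
  obtain ⟨v', rfl⟩ : ∃ v' : ℕ, v = v' := ⟨v.toNat, by omega⟩
  have hu : 1 ≤ u' := by omega
  by_cases hbig : 6 < u' + v'
  · apply sdomZ_of_tailCount_zero
    left
    rw [show ((u' : ℤ)).toNat = u' by omega, show ((v' : ℤ)).toNat = v' by omega]
    exact tailCount_parFin_eq_zero 6 _ hX u' v' hbig
  push Not at hbig
  rcases (show u' + v' = 6 ∨ u' + v' = 5 ∨ u' = v' + 1 ∨ (u' = 2 ∧ v' = 0) ∨ (u' = 1 ∧ v' = 1)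
      ∨ (u' = 3 ∧ v' = 0) ∨ (u' = 1 ∧ v' = 2) ∨ (u' = 4 ∧ v' = 0) ∨ (u' = 1 ∧ v' = 3)
      ∨ (u' = 3 ∧ v' = 1) ∨ (u' = 2 ∧ v' = 2) by omega)
    with h | h | h | ⟨h1, h2⟩ | ⟨h1, h2⟩ | ⟨h1, h2⟩ | ⟨h1, h2⟩ | ⟨h1, h2⟩ | ⟨h1, h2⟩ | ⟨h1, h2⟩ | ⟨h1, h2⟩
  · have := sdomZ_parFin_top 6 (fun _ => Y) u' hX hu (by omega)
    rwa [show 6 - u' = v' by omega] at this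
  · exact sdomZ_parFin_subtop_all 6 (fun _ => Y) u' v' hX hR' (by omega) hu
  · subst h
    have := sdomZ_parFin_diag 6 (fun _ => Y) (v' + 1) hX (by omega)
    push_cast at this
    simpa using this
  · subst h1; subst h2; exact IdentSix20.sdomZ_ident_Six20 hY hR
  · subst h1; subst h2; exact sdomZ_six_11 hY hR
  · subst h1; subst h2; exact IdentSix30.sdomZ_ident_Six30 hY hR
  · subst h1; subst h2; exact sdomZ_six_12 hY hR
  · subst h1; subst h2; exact IdentSix40.sdomZ_ident_Six40 hY hR
  · subst h1; subst h2; exact sdomZ_six_13 hY hR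
  · subst h1; subst h2; exact IdentSix31.sdomZ_ident_Six31 hY hR
  · subst h1; subst h2; exact sdomZ_six_22 hY hR

end Six

end Summit.Ventures.PercRepro2.Tail2D
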